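/-
Copyright (c) 2026. All rights reserved.
Released under Apache 2.0 license as described in the file LICENSE.
-/
import Summits.HubbardSuperconductivity.HubbardLadder.Bounds.HighTemperatureNoStiffnessCanonicalN
import HarnessLib

/-!
# Theorem 13_N with an explicit rate and an explicit threshold (bounds.tex §13, D5(f))

HONEST FRAMING: ladder R1–R4 with certified numbers; no claim on H/H₀. These are bounds for
MODEL CLASSES (the typed REPULSIVE `t–t'` Hubbard torus with a flux twist, fixed-`N` sectors),
no materials claim.

#211.25 `norm_ttSectorZ_twist_sub_le_window` gives `‖Z_N(θ) - Z_N(0)‖ ≤ G(L) Re Z_N(0)` with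
`G = twistWindowMajorant`, and #211.26 turns `G(L) → 0` into the nodes (i)_N, (ii)_N, (iv)_N with
an INEFFECTIVE `L₀(ε)` (from `Filter.Tendsto`). This part makes the threshold EXPLICIT:

* `twistWindowMajorant_le_exp_neg`: `3000 ≤ L → G(L) ≤ e^{-L/100}` (elementary:
  `x ≤ 1000e^{x/1000}`, `3.2·10⁹ ≤ e^{22}`, `32000 ≤ e^{11}` from `2.7182818283 < e`, and linear /
  quadratic exponent comparisons valid for `x ≥ 3000`);
* `norm_ttSectorZ_twist_sub_le_exp_neg`: in the window `0 < β`, `0 ≤ U`, `β(1 + |t'|) ≤ 10⁻⁴`,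
  `βU ≤ 1/500`, `3L² ≤ 5N ≤ 7L²` and for EVERY `L ≥ 3000` and every seam twist `θ`,
  `‖Z_N(θ) - Z_N(0)‖ ≤ e^{-L/100} Re Z_N(0)`;
* node `HighTemperatureTwistInsensitivityTT'CanonicalNRate` + `_holds` (the statement above as a
  `Prop` node, the effective form of Thm 13_N (i)_N) and
  `abs_log_ttSectorZ_twist_sub_le_exp_neg` (free-energy form:
  `|log Re Z_N(0) - log Re Z_N(θ)| ≤ 2e^{-L/100}` for `L ≥ 3000`);
* `norm_ttSectorZ_twist_sub_le_of_log_le` (EXPLICIT `L₀(ε)`): if moreover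
  `100·log(1/ε) ≤ L` then `‖Z_N(θ) - Z_N(0)‖ ≤ ε Re Z_N(0)` — i.e. the `L₀(ε)` of node (i)_N may be
  taken `max(3000, ⌈100 log(1/ε)⌉)`.

HONEST SIZE (stated, not hidden): `G(L) < 1` first at `L = 2881` (60-digit evaluation,
`code/d5_constants_B.py`), so the threshold `3000` is essentially the true reach of the device as
built (walk factor `e^{0.384L + 1606}`); the rate `1/100` is far from the true decay `≈ 0.566` per
unit `L` beyond the threshold and is chosen for a short kernel proof. The window
(`T ≥ 10⁴(|t| + |t'|)`, `T ≥ 500U`, `N/L² ∈ [3/5, 7/5]`) is smaller than the paper's `I_c4`;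
REPULSIVE class only; this is NOT a finite-`L` instance row at a physical size (`L = 3000` means
`9·10⁶` sites). Zero kit, no `native_decide`, standard axioms only.
References: R. Kotecký, D. Preiss, Comm. Math. Phys. 103 (1986) 491 [KoteckyPreiss1986];
D. Ueltschi, Analyticity in Hubbard models, J. Stat. Phys. 95 (1999) 693, §2.3 Prop. 2.2
[Ueltschi1999]; bounds.tex §13.
-/

noncomputable section

namespace Summit.HubbardSuperconductivity.HubbardLadder.Bounds

open Matrix Finset Complex
open Literature.MathematicalPhysics.QuantumLattice
open scoped ComplexOrder

/-! ### Elementary exponential bounds -/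

/-- `x ≤ 1000·e^{x/1000}` (from `1 + y ≤ e^y`). [this file] -/
theorem ttWindow_self_le_exp (x : ℝ) : x ≤ 1000 * Real.exp (x / 1000) := by
  have := Real.add_one_le_exp (x / 1000); linarith

/-- `x³ ≤ 10⁹·e^{3x/1000}` for `x ≥ 0`. [this file] -/
theorem ttWindow_cube_le_exp {x : ℝ} (hx : 0 ≤ x) :
    x ^ 3 ≤ 10 ^ 9 * Real.exp (3 * (x / 1000)) := by
  have h := pow_le_pow_left₀ hx (ttWindow_self_le_exp x) 3
  have e3 : Real.exp (x / 1000) ^ 3 = Real.exp (3 * (x / 1000)) := by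
    rw [show 3 * (x / 1000) = x / 1000 + x / 1000 + x / 1000 by ring, Real.exp_add, Real.exp_add]
    ring
  calc x ^ 3 ≤ (1000 * Real.exp (x / 1000)) ^ 3 := h
    _ = 10 ^ 9 * Real.exp (3 * (x / 1000)) := by rw [mul_pow, e3]; norm_num

/-- `3.2·10⁹ ≤ e^{22}` (from `2.7182818283 < e`). [this file] -/
theorem ttWindow_exp_22_ge : (32 / 10 * 10 ^ 9 : ℝ) ≤ Real.exp 22 := by
  have h1 : (2.7182818283 : ℝ) ≤ Real.exp 1 := Real.exp_one_gt_d9.le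
  have h2 : (2.7182818283 : ℝ) ^ 22 ≤ Real.exp 1 ^ 22 := pow_le_pow_left₀ (by norm_num) h1 22
  have h3 : Real.exp 1 ^ 22 = Real.exp 22 := by rw [← Real.exp_nat_mul]; all_goals norm_num
  calc (32 / 10 * 10 ^ 9 : ℝ) ≤ (2.7182818283 : ℝ) ^ 22 := by norm_num
    _ ≤ Real.exp 22 := h3 ▸ h2

/-- `32000 ≤ e^{11}` (from `2.7182818283 < e`). [this file] -/
theorem ttWindow_exp_11_ge : (32000 : ℝ) ≤ Real.exp 11 := by
  have h1 : (2.7182818283 : ℝ) ≤ Real.exp 1 := Real.exp_one_gt_d9.le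
  have h2 : (2.7182818283 : ℝ) ^ 11 ≤ Real.exp 1 ^ 11 := pow_le_pow_left₀ (by norm_num) h1 11
  have h3 : Real.exp 1 ^ 11 = Real.exp 11 := by rw [← Real.exp_nat_mul]; all_goals norm_num
  calc (32000 : ℝ) ≤ (2.7182818283 : ℝ) ^ 11 := by norm_num
    _ ≤ Real.exp 11 := h3 ▸ h2

/-! ### The majorant decays at the explicit rate `e^{-L/100}` beyond `L = 3000` -/

/-- Real-variable form: for `x ≥ 3000`,
`8x·e^{(48/125)x + 1606}·((1/5)x²e^{-(19/20)x} + 2e^{-x²/40}) ≤ e^{-x/100}`. The first term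
is `(8/5)x³e^{1606 - 0.566x} ≤ (8/5)10⁹e^{1606 - 0.563x} ≤ ½e^{1628 - 0.563x} ≤ ½e^{-x/100}`
(`1628 ≤ 0.553x`); the second is
`16x·e^{1606 + 0.384x - x²/40} ≤ ½e^{1617 + 0.385x - x²/40} ≤ ½e^{-x/100}`
(`x²/40 ≥ 75x`). [programme: bounds.tex §13 D5(f); this file] -/
theorem twistWindowMajorant_real_le_exp_neg {x : ℝ} (hx : 3000 ≤ x) :
    8 * x * Real.exp (48 / 125 * x + 1606) *
        (1 / 5 * x ^ 2 * Real.exp (-(19 / 20 * x)) + 2 * Real.exp (-(1 / 40 * x ^ 2))) ≤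
      Real.exp (-(x / 100)) := by
  have hx0 : 0 ≤ x := by linarith
  have e1 : Real.exp (48 / 125 * x + 1606) * Real.exp (-(19 / 20 * x)) =
      Real.exp (48 / 125 * x + 1606 - 19 / 20 * x) := by
    rw [sub_eq_add_neg]; exact (Real.exp_add _ _).symm
  have e2 : Real.exp (48 / 125 * x + 1606) * Real.exp (-(1 / 40 * x ^ 2)) =
      Real.exp (48 / 125 * x + 1606 - 1 / 40 * x ^ 2) := by
    rw [sub_eq_add_neg]; exact (Real.exp_add _ _).symm
  have hsplit : 8 * x * Real.exp (48 / 125 * x + 1606) *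
        (1 / 5 * x ^ 2 * Real.exp (-(19 / 20 * x)) + 2 * Real.exp (-(1 / 40 * x ^ 2))) =
      8 / 5 * x ^ 3 * (Real.exp (48 / 125 * x + 1606) * Real.exp (-(19 / 20 * x))) +
        16 * x * (Real.exp (48 / 125 * x + 1606) * Real.exp (-(1 / 40 * x ^ 2))) := by ring
  rw [hsplit, e1, e2]
  have hT1 : 8 / 5 * x ^ 3 * Real.exp (48 / 125 * x + 1606 - 19 / 20 * x) ≤
      1 / 2 * Real.exp (-(x / 100)) := by
    have hc := ttWindow_cube_le_exp hx0
    have hE := Real.exp_pos (48 / 125 * x + 1606 - 19 / 20 * x)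
    have h85 : (8 / 5 * 10 ^ 9 : ℝ) ≤ 1 / 2 * Real.exp 22 := by linarith [ttWindow_exp_22_ge]
    have eA : Real.exp (3 * (x / 1000)) * Real.exp (48 / 125 * x + 1606 - 19 / 20 * x) =
        Real.exp (3 * (x / 1000) + (48 / 125 * x + 1606 - 19 / 20 * x)) := (Real.exp_add _ _).symm
    have eB : Real.exp 22 * Real.exp (3 * (x / 1000) + (48 / 125 * x + 1606 - 19 / 20 * x)) =
        Real.exp (22 + (3 * (x / 1000) + (48 / 125 * x + 1606 - 19 / 20 * x))) :=
      (Real.exp_add _ _).symm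
    have hmono : Real.exp (22 + (3 * (x / 1000) + (48 / 125 * x + 1606 - 19 / 20 * x))) ≤
        Real.exp (-(x / 100)) := Real.exp_le_exp.2 (by linarith)
    calc 8 / 5 * x ^ 3 * Real.exp (48 / 125 * x + 1606 - 19 / 20 * x)
        ≤ 8 / 5 * (10 ^ 9 * Real.exp (3 * (x / 1000))) *
            Real.exp (48 / 125 * x + 1606 - 19 / 20 * x) :=
          mul_le_mul_of_nonneg_right (mul_le_mul_of_nonneg_left hc (by norm_num)) hE.le
      _ = 8 / 5 * 10 ^ 9 * (Real.exp (3 * (x / 1000)) *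
            Real.exp (48 / 125 * x + 1606 - 19 / 20 * x)) := by ring
      _ ≤ 1 / 2 * Real.exp 22 * (Real.exp (3 * (x / 1000)) *
            Real.exp (48 / 125 * x + 1606 - 19 / 20 * x)) :=
          mul_le_mul_of_nonneg_right h85 (by positivity)
      _ = 1 / 2 * Real.exp (22 + (3 * (x / 1000) + (48 / 125 * x + 1606 - 19 / 20 * x))) := by
          rw [eA, ← eB]; ring
      _ ≤ 1 / 2 * Real.exp (-(x / 100)) := by linarith [hmono]
  have hT2 : 16 * x * Real.exp (48 / 125 * x + 1606 - 1 / 40 * x ^ 2) ≤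
      1 / 2 * Real.exp (-(x / 100)) := by
    have hs := ttWindow_self_le_exp x
    have hxx : 3000 * x ≤ x * x := mul_le_mul_of_nonneg_right hx hx0
    have hE := Real.exp_pos (48 / 125 * x + 1606 - 1 / 40 * x ^ 2)
    have h16 : (16000 : ℝ) ≤ 1 / 2 * Real.exp 11 := by linarith [ttWindow_exp_11_ge]
    have eA : Real.exp (x / 1000) * Real.exp (48 / 125 * x + 1606 - 1 / 40 * x ^ 2) =
        Real.exp (x / 1000 + (48 / 125 * x + 1606 - 1 / 40 * x ^ 2)) := (Real.exp_add _ _).symm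
    have eB : Real.exp 11 * Real.exp (x / 1000 + (48 / 125 * x + 1606 - 1 / 40 * x ^ 2)) =
        Real.exp (11 + (x / 1000 + (48 / 125 * x + 1606 - 1 / 40 * x ^ 2))) :=
      (Real.exp_add _ _).symm
    have hmono : Real.exp (11 + (x / 1000 + (48 / 125 * x + 1606 - 1 / 40 * x ^ 2))) ≤
        Real.exp (-(x / 100)) := Real.exp_le_exp.2 (by nlinarith [hxx])
    calc 16 * x * Real.exp (48 / 125 * x + 1606 - 1 / 40 * x ^ 2)
        ≤ 16 * (1000 * Real.exp (x / 1000)) * Real.exp (48 / 125 * x + 1606 - 1 / 40 * x ^ 2) :=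
          mul_le_mul_of_nonneg_right (mul_le_mul_of_nonneg_left hs (by norm_num)) hE.le
      _ = 16000 * (Real.exp (x / 1000) * Real.exp (48 / 125 * x + 1606 - 1 / 40 * x ^ 2)) := by
          ring
      _ ≤ 1 / 2 * Real.exp 11 * (Real.exp (x / 1000) *
            Real.exp (48 / 125 * x + 1606 - 1 / 40 * x ^ 2)) :=
          mul_le_mul_of_nonneg_right h16 (by positivity)
      _ = 1 / 2 * Real.exp (11 + (x / 1000 + (48 / 125 * x + 1606 - 1 / 40 * x ^ 2))) := by
          rw [eA, ← eB]; ring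
      _ ≤ 1 / 2 * Real.exp (-(x / 100)) := by linarith [hmono]
  linarith [hT1, hT2]

/-- `twistWindowMajorant L ≤ e^{-L/100}` for `L ≥ 3000`.
[programme: bounds.tex §13 D5(f); this file] -/
theorem twistWindowMajorant_le_exp_neg {L : ℕ} (hL : 3000 ≤ L) :
    twistWindowMajorant L ≤ Real.exp (-((L : ℝ) / 100)) := by
  unfold twistWindowMajorant
  exact twistWindowMajorant_real_le_exp_neg (by exact_mod_cast hL)

/-! ### Theorem 13_N with the explicit rate, the node, the log form and the explicit `L₀(ε)` -/

section Sector

variable {L : ℕ} [NeZero L]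

/-- THEOREM 13_N WITH AN EXPLICIT RATE: in the window `0 < β`, `0 ≤ U`, `β(1 + |t'|) ≤ 10⁻⁴`,
`βU ≤ 1/500`, `3L² ≤ 5N ≤ 7L²`, for every `L ≥ 3000` and every seam twist `θ`,
`‖Z_N(θ) - Z_N(0)‖ ≤ e^{-L/100} · Re Z_N(0)`.
[programme: bounds.tex §13 Theorem 13_N, D5(f); this file] -/
theorem norm_ttSectorZ_twist_sub_le_exp_neg (hL : 3000 ≤ L) {β : ℝ} (hβ : 0 < β) {U : ℝ}
    (hU : 0 ≤ U) (t' θ : ℝ) (hS : β * (1 + |t'|) ≤ 1 / 10000) (hu : β * U ≤ 1 / 500) {N : ℕ}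
    (hN₁ : 3 * L ^ 2 ≤ 5 * N) (hN₂ : 5 * N ≤ 7 * L ^ 2) :
    ‖ttSectorZ L β t' U θ N - ttSectorZ L β t' U 0 N‖ ≤
      Real.exp (-((L : ℝ) / 100)) * (ttSectorZ L β t' U 0 N).re := by
  have h := norm_ttSectorZ_twist_sub_le_window (le_trans (by norm_num) hL) hβ hU t' θ hS hu hN₁ hN₂
  have hΛ : Fintype.card (FermionTorus 2 L) = L ^ 2 := by simp [FermionTorus, Fintype.card_lex]
  have hO : Fintype.card (Orb (FermionTorus 2 L)) = 2 * L ^ 2 := by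
    rw [Fintype.card_lex, Fintype.card_prod, Fintype.card_fin, hΛ, mul_comm]
  have hre : 0 ≤ (ttSectorZ L β t' U 0 N).re := (ttSectorZ_pos β t' U 0 (by omega)).1.le
  exact h.trans (mul_le_mul_of_nonneg_right (twistWindowMajorant_le_exp_neg hL) hre)

/-- Free-energy form with the explicit rate: for `L ≥ 3000` in the window,
`|log Re Z_N(0) - log Re Z_N(θ)| ≤ 2e^{-L/100}` (`e^{-L/100} ≤ e^{-30} ≤ 1/2`).
[programme: bounds.tex §13 Theorem 13_N (i)_N, D5(f); this file] -/
theorem abs_log_ttSectorZ_twist_sub_le_exp_neg (hL : 3000 ≤ L) {β : ℝ} (hβ : 0 < β) {U : ℝ}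
    (hU : 0 ≤ U) (t' θ : ℝ) (hS : β * (1 + |t'|) ≤ 1 / 10000) (hu : β * U ≤ 1 / 500) {N : ℕ}
    (hN₁ : 3 * L ^ 2 ≤ 5 * N) (hN₂ : 5 * N ≤ 7 * L ^ 2) :
    |Real.log (ttSectorZ L β t' U 0 N).re - Real.log (ttSectorZ L β t' U θ N).re| ≤
      2 * Real.exp (-((L : ℝ) / 100)) := by
  have h := norm_ttSectorZ_twist_sub_le_exp_neg hL hβ hU t' θ hS hu hN₁ hN₂
  have hΛ : Fintype.card (FermionTorus 2 L) = L ^ 2 := by simp [FermionTorus, Fintype.card_lex]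
  have hO : Fintype.card (Orb (FermionTorus 2 L)) = 2 * L ^ 2 := by
    rw [Fintype.card_lex, Fintype.card_prod, Fintype.card_fin, hΛ, mul_comm]
  have hpos := (ttSectorZ_pos β t' U 0 (k := N) (L := L) (by omega)).1
  have hre : |(ttSectorZ L β t' U θ N).re - (ttSectorZ L β t' U 0 N).re| ≤
      Real.exp (-((L : ℝ) / 100)) * (ttSectorZ L β t' U 0 N).re := by
    rw [← Complex.sub_re]; exact (Complex.abs_re_le_norm _).trans h
  have hhalf : Real.exp (-((L : ℝ) / 100)) ≤ 1 / 2 := by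
    have hL' : (3000 : ℝ) ≤ L := by exact_mod_cast hL
    have h1 : Real.exp (-((L : ℝ) / 100)) ≤ Real.exp (-1) :=
      Real.exp_le_exp.2 (by linarith)
    have h2 : Real.exp (-1 : ℝ) ≤ 1 / 2 := by
      have h3 : (2 : ℝ) ≤ Real.exp 1 := by linarith [Real.add_one_le_exp (1 : ℝ)]
      rw [Real.exp_neg]
      calc (Real.exp 1)⁻¹ ≤ (2 : ℝ)⁻¹ := inv_anti₀ (by norm_num) h3
        _ = 1 / 2 := by norm_num
    exact h1.trans h2
  exact ttWindow_abs_log_sub_log_le hpos hhalf hre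

/-- EXPLICIT `L₀(ε)` for node (i)_N: if `L ≥ 3000` and `100·log(1/ε) ≤ L` then, in the window,
`‖Z_N(θ) - Z_N(0)‖ ≤ ε · Re Z_N(0)` — so `L₀(ε) = max(3000, ⌈100 log(1/ε)⌉)` works in
`HighTemperatureTwistInsensitivityTT'CanonicalN`. [programme: bounds.tex §13 D5(f); this file] -/
theorem norm_ttSectorZ_twist_sub_le_of_log_le (hL : 3000 ≤ L) {ε : ℝ} (hε : 0 < ε)
    (hLε : 100 * Real.log (1 / ε) ≤ L) {β : ℝ} (hβ : 0 < β) {U : ℝ} (hU : 0 ≤ U) (t' θ : ℝ)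
    (hS : β * (1 + |t'|) ≤ 1 / 10000) (hu : β * U ≤ 1 / 500) {N : ℕ}
    (hN₁ : 3 * L ^ 2 ≤ 5 * N) (hN₂ : 5 * N ≤ 7 * L ^ 2) :
    ‖ttSectorZ L β t' U θ N - ttSectorZ L β t' U 0 N‖ ≤ ε * (ttSectorZ L β t' U 0 N).re := by
  have h := norm_ttSectorZ_twist_sub_le_exp_neg hL hβ hU t' θ hS hu hN₁ hN₂
  have hΛ : Fintype.card (FermionTorus 2 L) = L ^ 2 := by simp [FermionTorus, Fintype.card_lex]
  have hO : Fintype.card (Orb (FermionTorus 2 L)) = 2 * L ^ 2 := by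
    rw [Fintype.card_lex, Fintype.card_prod, Fintype.card_fin, hΛ, mul_comm]
  have hre : 0 ≤ (ttSectorZ L β t' U 0 N).re := (ttSectorZ_pos β t' U 0 (by omega)).1.le
  have hexp : Real.exp (-((L : ℝ) / 100)) ≤ ε := by
    have hlog : Real.log (1 / ε) = -Real.log ε := by rw [one_div, Real.log_inv]
    have h1 : -((L : ℝ) / 100) ≤ Real.log ε := by rw [hlog] at hLε; linarith
    calc Real.exp (-((L : ℝ) / 100)) ≤ Real.exp (Real.log ε) := Real.exp_le_exp.2 h1
      _ = ε := Real.exp_log hε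
  exact h.trans (mul_le_mul_of_nonneg_right hexp hre)

/-- NODE (Theorem 13_N (i)_N with an EXPLICIT rate and threshold; REPULSIVE `t–t'` Hubbard torus,
fixed-`N` sectors): in the window `0 < β`, `0 ≤ U`, `β(1 + |t'|) ≤ 10⁻⁴`, `βU ≤ 1/500`, for every
`L ≥ 3000`, every `N` with `3L² ≤ 5N ≤ 7L²` and every seam twist `θ`,
`‖Z_N(θ) - Z_N(0)‖ ≤ e^{-L/100} · Re Z_N(0)`, `Z_N(θ) = ttSectorZ L β t' U θ N`.
HONEST SIZE: `L ≥ 3000` is `≥ 9·10⁶` sites; the threshold is the true reach of the device as built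
(`twistWindowMajorant < 1` first at `L = 2881`), not a physical-size instance row.
[programme: bounds.tex §13 Theorem 13_N (i)_N, D5(f); this file] -/
@[conjecture] def HighTemperatureTwistInsensitivityTT'CanonicalNRate : Prop :=
  ∀ (L : ℕ) [NeZero L], 3000 ≤ L → ∀ (t' U β : ℝ), 0 < β → 0 ≤ U →
    β * (1 + |t'|) ≤ 1 / 10000 → β * U ≤ 1 / 500 → ∀ N : ℕ, 3 * L ^ 2 ≤ 5 * N →
    5 * N ≤ 7 * L ^ 2 → ∀ θ : ℝ,
      ‖ttSectorZ L β t' U θ N - ttSectorZ L β t' U 0 N‖ ≤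
        Real.exp (-((L : ℝ) / 100)) * (ttSectorZ L β t' U 0 N).re

/-- The explicit-rate node HOLDS (kernel-checked; one line from
`norm_ttSectorZ_twist_sub_le_exp_neg`). [programme: bounds.tex §13 D5(f); this file] -/
theorem highTemperatureTwistInsensitivityTT'CanonicalNRate_holds :
    HighTemperatureTwistInsensitivityTT'CanonicalNRate := by
  intro L _ hL t' U β hβ hU hS hu N hN₁ hN₂ θ
  exact norm_ttSectorZ_twist_sub_le_exp_neg hL hβ hU t' θ hS hu hN₁ hN₂

end Sector

end Summit.HubbardSuperconductivity.HubbardLadder.Bounds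

end
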